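import Mathlib.LinearAlgebra.Span.Basic
import Mathlib.Tactic.LinearCombination
import Mathlib.Tactic.Module
import Mathlib.Tactic.Ring
import HarnessLib

/-!
# Irreducibility of a representation generated along one orbit of (generalised) reflections
# (the linear-algebra half of the Picard–Lefschetz irreducibility theorem)

Topic `LinearAlgebra`; theorems only (no definitions, no named facts). Written by the literature seat
`hodge-nonav-lit` (g28, cell `hodge-nonav`) at the planner's request (p3 g37, 2026-08-29T15:34:13Z) as the
ALGEBRAIC HALF of the uniform irreducibility engine «E-PL» for the `e ≥ 6` range of route
`HodgeConjecture/Q8SymplecticPowers` (crux K1Q, `stmt-HodgeConjecture-24190`, stub `S9_{≥6}`), where the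
local monodromies are BIREFLECTIONS (eigenvalues `i, -i` on a root plane, identity on its mirror; the
currency of stub S5 `stub_monodromyBireflectionQ`) rather than the rank-one reflections of the classical
theory.

## The source

C. Voisin, *Hodge Theory and Complex Algebraic Geometry II* (held `book:voisin2003-hodge-theory-complex-
algebraic-geometry-ii`), §3.2.3, proof of **Theorem 3.27** (irreducibility of the monodromy action on
`H^{n-1}(X_0, ℚ)_van`), chunks p0102–p0103: *"By lemma 2.26, the vanishing cohomology is generated by the
vanishing cycles δ_i of the pencil"*; these are all conjugate under the monodromy (Cor. 3.24); and a
stable subspace `F` either contains some `δ_i` — because `T_i(α) - α = ± ⟨α, δ_i⟩ δ_i` (Picard–Lefschetz,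
Thm. 2.16/3.16) — hence all of them, hence everything, or is orthogonal to every `δ_i`, hence zero.
The same argument is Deligne, *Weil II* §4.4 (Lemme 4.4.2) and, for complex reflections of a unitary
reflection group, Carlson–Toledo 1999 §7 — the latter already in the tree as
`Literature.AlgebraicGeometry.HodgeTheory.eq_bot_or_eq_top_of_forall_map_mem` (rank-ONE `λ`-reflections
`complexReflection B ε λ δ` for a sesquilinear `B`). The present file isolates the form-free skeleton of
the argument and extends the «capture» step from rank one to rank two, which is what bireflections need.

## Contents (field `K`, `K`-space `V`, an ambient `Γ`-stable piece `M ≤ V`, an acting SET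
`S ⊆ End_K(V)` — e.g. the image of a finite-index subgroup of monodromy under `γ ↦ γ ⊗ ℂ`)

* §1 CAPTURE. `mem_or_forall_eq_of_sub_mem_span_singleton` — if `g x - x ∈ K ∙ p` on `M` (a generalised
  reflection with root `p`: reflections, transvections), a `g`-stable `U ≤ M` contains `p` or is fixed
  pointwise by `g`. `mem_or_mem_or_forall_eq_of_sub_mem_span_pair` — if `g x - x ∈ ⟨p, q⟩` on `M` with
  `g p = a p`, `g q = b q`, `a ≠ b` (a generalised BIREFLECTION with root lines `K p`, `K q`), a `g`-stable
  `U ≤ M` contains `p`, or contains `q`, or is fixed pointwise by `g`.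
  `sub_mem_span_pair_of_forall_eq` — the range clause from the MIRROR clause of stub S5's currency: if
  `g` fixes `M ∩ ker φ ∩ ker ψ` for two functionals whose Gram determinant on `(p, q)` is non-zero, then
  `g x - x ∈ ⟨p, q⟩` on `M`; `apply_eq_zero_of_forall_eq` — conversely a `g`-fixed vector of `M` lies in
  the mirror when `a, b ≠ 1`.
* §2 ORBIT. `eq_bot_or_eq_of_stable_of_reflections` / `eq_bot_or_eq_of_stable_of_bireflections` — **if
  the roots of a family of generalised (bi)reflections in `S` lie in `M` and span it, every root lies in
  the `K`-span of the `S`-orbit of every other root («one orbit»), and no non-zero vector of `M` is fixed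
  by the whole family («the mirrors meet `M` trivially» — for a non-degenerate form: `⋂ δ^⊥ = 0`), then an
  `S`-stable `U ≤ M` is `⊥` or `M`.** `eq_bot_or_eq_of_stable_of_bireflections_of_mirrors` — the same
  with the mirrors given by pairs of functionals (S5 currency: `φ_j = Q_f(·, B ℓp_j)`, `ψ_j = Q_f(·, B ℓm_j)`)
  and the fixed-vector hypothesis replaced by «the functionals separate `M`».

Honest scope: pure linear algebra; the geometric inputs of «E-PL» (the root lines of the local
bireflections SPAN the eigen-piece = Picard–Lefschetz generation; they form ONE orbit under every
finite-index subgroup = irreducibility of the discriminant stratum) are hypotheses here, and nothing in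
this file bears on HC.

## References

* [VoisinHodgeII2003] C. Voisin, *Hodge Theory and Complex Algebraic Geometry II*, CUP (2003), §2.3.2
  Lemma 2.26, §3.2.2 Cor. 3.24, §3.2.3 Thm. 3.27 (proof).
* [Deligne1980] P. Deligne, *La conjecture de Weil. II*, Publ. Math. IHÉS 52 (1980), §4.4 (4.4.1–4.4.2).
* [CarlsonToledo1999] J. A. Carlson, D. Toledo, Duke Math. J. 97 (1999), §7 (unitary reflection groups).
* [Lamotke1981] K. Lamotke, *The topology of complex projective varieties after S. Lefschetz*, Topology 20
  (1981), §7 (the main lemma).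
-/

namespace Literature.LinearAlgebra

variable {K : Type*} [Field K] {V : Type*} [AddCommGroup V] [Module K V]

/-! ### §1 Capture: a stable subspace not inside the mirror contains a root -/

section Capture

/-- **Rank-one capture.** If `g - 1` maps `M` into the line `K ∙ p` (a generalised reflection —
reflection, pseudo-reflection or transvection — with root `p`), then a `g`-stable subspace `U ≤ M` either
contains the root `p` or is fixed pointwise by `g` (lies in the mirror): `g x - x = c • p ∈ U` with
`c ≠ 0` for some `x ∈ U` unless `g` fixes `U`. This is the step «`T_i(α) - α = ±⟨α, δ_i⟩ δ_i`, so `F`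
contains `δ_i` unless `F ⊥ δ_i`» of the proof of Voisin's Theorem 3.27.
[cite: VoisinHodgeII2003, §3.2.3 proof of Thm. 3.27] [cite: Deligne1980, §4.4] -/
theorem mem_or_forall_eq_of_sub_mem_span_singleton {g : Module.End K V} {M : Submodule K V} {p : V}
    (hg : ∀ x ∈ M, g x - x ∈ K ∙ p) {U : Submodule K V} (hUM : U ≤ M) (hU : ∀ x ∈ U, g x ∈ U) :
    p ∈ U ∨ ∀ x ∈ U, g x = x := by
  by_cases h : ∀ x ∈ U, g x = x
  · exact Or.inr h
  left
  push Not at h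
  obtain ⟨x, hxU, hx⟩ := h
  obtain ⟨c, hc⟩ := Submodule.mem_span_singleton.1 (hg x (hUM hxU))
  have hc0 : c ≠ 0 := by
    rintro rfl
    rw [zero_smul] at hc
    exact hx (sub_eq_zero.1 hc.symm)
  have hmem : c • p ∈ U := hc ▸ U.sub_mem (hU x hxU) hxU
  have h' := U.smul_mem c⁻¹ hmem
  rwa [smul_smul, inv_mul_cancel₀ hc0, one_smul] at h'

/-- **Rank-two capture (bireflections).** If `g - 1` maps `M` into the plane `⟨p, q⟩` and `p`, `q`
are eigenvectors of `g` with DISTINCT eigenvalues `a ≠ b` (a generalised bireflection with root lines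
`K p`, `K q` — e.g. a monodromy acting as `i` on `ℓp`, `-i` on `ℓm` and trivially on the mirror), then a
`g`-stable subspace `U ≤ M` contains `p`, or contains `q`, or is fixed pointwise by `g`: for `x ∈ U` with
`y := g x - x = α p + β q ≠ 0` one has `g y - b y = α (a - b) p ∈ U`, so `p ∈ U` if `α ≠ 0` and
`q ∈ U` otherwise. (The rank-two version of the capture step of Voisin's Theorem 3.27.)
[cite: VoisinHodgeII2003, §3.2.3 proof of Thm. 3.27] [cite: Deligne1980, §4.4] -/
theorem mem_or_mem_or_forall_eq_of_sub_mem_span_pair {g : Module.End K V} {M : Submodule K V}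
    {p q : V} {a b : K} (hg : ∀ x ∈ M, g x - x ∈ Submodule.span K {p, q}) (hp : g p = a • p)
    (hq : g q = b • q) (hab : a ≠ b) {U : Submodule K V} (hUM : U ≤ M) (hU : ∀ x ∈ U, g x ∈ U) :
    p ∈ U ∨ q ∈ U ∨ ∀ x ∈ U, g x = x := by
  by_cases h : ∀ x ∈ U, g x = x
  · exact Or.inr (Or.inr h)
  push Not at h
  obtain ⟨x, hxU, hx⟩ := h
  have hy : g x - x ∈ U := U.sub_mem (hU x hxU) hxU
  obtain ⟨α, β, hαβ⟩ := Submodule.mem_span_pair.1 (hg x (hUM hxU))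
  have hz : g (g x - x) - b • (g x - x) ∈ U := U.sub_mem (hU _ hy) (U.smul_mem b hy)
  have hz' : g (g x - x) - b • (g x - x) = (α * (a - b)) • p := by
    rw [← hαβ]
    simp only [map_add, map_smul, hp, hq]
    module
  rw [hz'] at hz
  by_cases hα : α = 0
  · subst hα
    right
    left
    rw [zero_smul, zero_add] at hαβ
    have hβ : β ≠ 0 := by
      rintro rfl
      rw [zero_smul] at hαβ
      exact hx (sub_eq_zero.1 hαβ.symm)
    have hmem : β • q ∈ U := hαβ ▸ hy
    have h' := U.smul_mem β⁻¹ hmem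
    rwa [smul_smul, inv_mul_cancel₀ hβ, one_smul] at h'
  · left
    have hc : α * (a - b) ≠ 0 := mul_ne_zero hα (sub_ne_zero.2 hab)
    have h' := U.smul_mem (α * (a - b))⁻¹ hz
    rwa [smul_smul, inv_mul_cancel₀ hc, one_smul] at h'

/-- **From the mirror clause to the range clause.** Let `p, q ∈ M` be eigenvectors of `g` and let
`φ, ψ` be two linear functionals whose Gram determinant `φ p · ψ q - φ q · ψ p` on `(p, q)` is non-zero.
If `g` fixes every vector of `M` killed by `φ` and `ψ` (the MIRROR clause of stub S5's currency:
`Q_f(x, B ℓp) = 0 → Q_f(x, B ℓm) = 0 → γ x = x`), then `g x - x ∈ ⟨p, q⟩` for all `x ∈ M`: write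
`x = h + α p + β q` with `h` in the mirror (Cramer's rule). [cite: VoisinHodgeII2003, §3.2.3 proof of
Thm. 3.27 (the orthogonal decomposition `α = ⟨α, δ⟩δ + α^⊥` for a rank-two root space)] -/
theorem sub_mem_span_pair_of_forall_eq {g : Module.End K V} {M : Submodule K V} {p q : V}
    (hpM : p ∈ M) (hqM : q ∈ M) {a b : K} (hp : g p = a • p) (hq : g q = b • q) (φ ψ : V →ₗ[K] K)
    (hD : φ p * ψ q - φ q * ψ p ≠ 0) (hfix : ∀ x ∈ M, φ x = 0 → ψ x = 0 → g x = x) :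
    ∀ x ∈ M, g x - x ∈ Submodule.span K {p, q} := by
  intro x hxM
  set α := (φ x * ψ q - φ q * ψ x) / (φ p * ψ q - φ q * ψ p) with hα
  set β := (φ p * ψ x - φ x * ψ p) / (φ p * ψ q - φ q * ψ p) with hβ
  have hsumφ : α * φ p + β * φ q = φ x := by
    have key : (φ x * ψ q - φ q * ψ x) * φ p + (φ p * ψ x - φ x * ψ p) * φ q =
        φ x * (φ p * ψ q - φ q * ψ p) := by ring
    rw [hα, hβ, div_mul_eq_mul_div, div_mul_eq_mul_div, ← add_div, key, mul_div_assoc,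
      div_self hD, mul_one]
  have hsumψ : α * ψ p + β * ψ q = ψ x := by
    have key : (φ x * ψ q - φ q * ψ x) * ψ p + (φ p * ψ x - φ x * ψ p) * ψ q =
        ψ x * (φ p * ψ q - φ q * ψ p) := by ring
    rw [hα, hβ, div_mul_eq_mul_div, div_mul_eq_mul_div, ← add_div, key, mul_div_assoc,
      div_self hD, mul_one]
  have hφ : φ (x - α • p - β • q) = 0 := by
    simp only [map_sub, map_smul, smul_eq_mul]
    linear_combination (-1 : K) * hsumφ
  have hψ : ψ (x - α • p - β • q) = 0 := by
    simp only [map_sub, map_smul, smul_eq_mul]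
    linear_combination (-1 : K) * hsumψ
  have hh : g (x - α • p - β • q) = x - α • p - β • q :=
    hfix _ (M.sub_mem (M.sub_mem hxM (M.smul_mem α hpM)) (M.smul_mem β hqM)) hφ hψ
  have hx : g x - x = (α * (a - 1)) • p + (β * (b - 1)) • q := by
    have e1 : g x = g ((x - α • p - β • q) + α • p + β • q) := by congr 1; module
    rw [e1]
    simp only [map_add, map_smul, hh, hp, hq]
    module
  rw [hx]
  exact Submodule.add_mem _ (Submodule.smul_mem _ _ (Submodule.subset_span (by simp)))
    (Submodule.smul_mem _ _ (Submodule.subset_span (by simp)))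

/-- **A fixed vector lies in the mirror** (when the eigenvalues on the root plane differ from `1`): with
the data of `sub_mem_span_pair_of_forall_eq` and `a ≠ 1`, `b ≠ 1`, every `x ∈ M` with `g x = x`
satisfies `φ x = 0` and `ψ x = 0`. (So «no non-zero vector of `M` is fixed by all the bireflections» is
the same as «the mirror functionals separate `M`», i.e. `⋂ δ^⊥ = 0` in Voisin's proof.)
[cite: VoisinHodgeII2003, §3.2.3 proof of Thm. 3.27] -/
theorem apply_eq_zero_of_forall_eq {g : Module.End K V} {M : Submodule K V} {p q : V}
    (hpM : p ∈ M) (hqM : q ∈ M) {a b : K} (hp : g p = a • p) (hq : g q = b • q) (ha : a ≠ 1)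
    (hb : b ≠ 1) (φ ψ : V →ₗ[K] K) (hD : φ p * ψ q - φ q * ψ p ≠ 0)
    (hfix : ∀ x ∈ M, φ x = 0 → ψ x = 0 → g x = x) {x : V} (hxM : x ∈ M) (hgx : g x = x) :
    φ x = 0 ∧ ψ x = 0 := by
  set α := (φ x * ψ q - φ q * ψ x) / (φ p * ψ q - φ q * ψ p) with hα
  set β := (φ p * ψ x - φ x * ψ p) / (φ p * ψ q - φ q * ψ p) with hβ
  have hsumφ : α * φ p + β * φ q = φ x := by
    have key : (φ x * ψ q - φ q * ψ x) * φ p + (φ p * ψ x - φ x * ψ p) * φ q =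
        φ x * (φ p * ψ q - φ q * ψ p) := by ring
    rw [hα, hβ, div_mul_eq_mul_div, div_mul_eq_mul_div, ← add_div, key, mul_div_assoc,
      div_self hD, mul_one]
  have hsumψ : α * ψ p + β * ψ q = ψ x := by
    have key : (φ x * ψ q - φ q * ψ x) * ψ p + (φ p * ψ x - φ x * ψ p) * ψ q =
        ψ x * (φ p * ψ q - φ q * ψ p) := by ring
    rw [hα, hβ, div_mul_eq_mul_div, div_mul_eq_mul_div, ← add_div, key, mul_div_assoc,
      div_self hD, mul_one]
  have hφ : φ (x - α • p - β • q) = 0 := by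
    simp only [map_sub, map_smul, smul_eq_mul]
    linear_combination (-1 : K) * hsumφ
  have hψ : ψ (x - α • p - β • q) = 0 := by
    simp only [map_sub, map_smul, smul_eq_mul]
    linear_combination (-1 : K) * hsumψ
  have hh : g (x - α • p - β • q) = x - α • p - β • q :=
    hfix _ (M.sub_mem (M.sub_mem hxM (M.smul_mem α hpM)) (M.smul_mem β hqM)) hφ hψ
  -- `0 = g x - x = α (a - 1) p + β (b - 1) q`, and `p`, `q` are independent (Gram determinant ≠ 0)
  have hx : (α * (a - 1)) • p + (β * (b - 1)) • q = 0 := by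
    have e1 : g x = g ((x - α • p - β • q) + α • p + β • q) := by congr 1; module
    have e2 : g x - x = (α * (a - 1)) • p + (β * (b - 1)) • q := by
      rw [e1]
      simp only [map_add, map_smul, hh, hp, hq]
      module
    rw [← e2, hgx, sub_self]
  -- apply `φ` and `ψ`: a `2 × 2` system with non-zero determinant
  have h1 : α * (a - 1) * φ p + β * (b - 1) * φ q = 0 := by
    simpa [map_add, map_smul, smul_eq_mul] using congrArg φ hx
  have h2 : α * (a - 1) * ψ p + β * (b - 1) * ψ q = 0 := by
    simpa [map_add, map_smul, smul_eq_mul] using congrArg ψ hx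
  have hαa : α * (a - 1) = 0 := by
    have : α * (a - 1) * (φ p * ψ q - φ q * ψ p) = 0 := by
      linear_combination ψ q * h1 - φ q * h2
    exact (mul_eq_zero.1 this).resolve_right hD
  have hβb : β * (b - 1) = 0 := by
    have : β * (b - 1) * (φ p * ψ q - φ q * ψ p) = 0 := by
      linear_combination φ p * h2 - ψ p * h1
    exact (mul_eq_zero.1 this).resolve_right hD
  have hα0 : α = 0 := (mul_eq_zero.1 hαa).resolve_right (sub_ne_zero.2 ha)
  have hβ0 : β = 0 := (mul_eq_zero.1 hβb).resolve_right (sub_ne_zero.2 hb)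
  rw [hα0, hβ0, zero_smul, zero_smul, sub_zero, sub_zero] at hφ hψ
  exact ⟨hφ, hψ⟩

end Capture

/-! ### §2 One orbit of roots spanning `M` ⇒ `M` is irreducible -/

section Orbit

/-- **Irreducibility along one orbit of generalised reflections** (the linear-algebra half of the
Picard–Lefschetz irreducibility theorem, Voisin II Thm. 3.27; Deligne, Weil II 4.4.1–4.4.2). Let
`S ⊆ End_K(V)` be a set of endomorphisms, `M ≤ V` a subspace, and `γ_j ∈ S` a family of generalised
reflections with roots `p_j` (`γ_j x - x ∈ K ∙ p_j` on `M`). Assume: (span) the roots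
span `M`; (orbit) every root lies in the `K`-span of the `S`-orbit of every other root; (mirrors) no
non-zero vector of `M` is fixed by all the `γ_j`. Then every `S`-stable `U ≤ M` is `⊥` or `M`.
[cite: VoisinHodgeII2003, §3.2.3 Thm. 3.27 (proof) with Lemma 2.26 and Cor. 3.24]
[cite: Deligne1980, §4.4] -/
theorem eq_bot_or_eq_of_stable_of_reflections (S : Set (Module.End K V)) (M : Submodule K V)
    {J : Type*} {γ : J → Module.End K V} (hγS : ∀ j, γ j ∈ S) {p : J → V}
    (hrange : ∀ j, ∀ x ∈ M, γ j x - x ∈ K ∙ p j) (hmir : ∀ x ∈ M, (∀ j, γ j x = x) → x = 0)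
    (horbit : ∀ j j', p j' ∈ Submodule.span K ((fun g : Module.End K V => g (p j)) '' S))
    (hspan : M ≤ Submodule.span K (Set.range p)) {U : Submodule K V} (hUM : U ≤ M)
    (hU : ∀ g ∈ S, ∀ x ∈ U, g x ∈ U) : U = ⊥ ∨ U = M := by
  classical
  rcases eq_or_ne U ⊥ with hU0 | hU0
  · exact Or.inl hU0
  right
  obtain ⟨x, hxU, hx0⟩ := (Submodule.ne_bot_iff U).1 hU0
  -- some `γ_j` moves `x`, so its root is captured
  have hj : ∃ j, γ j x ≠ x := by
    by_contra h
    push Not at h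
    exact hx0 (hmir x (hUM hxU) h)
  obtain ⟨j, hjx⟩ := hj
  have hpj : p j ∈ U := by
    rcases mem_or_forall_eq_of_sub_mem_span_singleton (hrange j) hUM (hU _ (hγS j)) with h | h
    · exact h
    · exact absurd (h x hxU) hjx
  -- hence every root lies in `U`, and `U = M`
  have hall : ∀ j', p j' ∈ U := fun j' ↦ by
    refine (Submodule.span_le.2 ?_) (horbit j j')
    rintro _ ⟨g, hg, rfl⟩
    exact hU g hg _ hpj
  refine le_antisymm hUM (hspan.trans (Submodule.span_le.2 ?_))
  rintro _ ⟨j', rfl⟩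
  exact hall j'

/-- **Irreducibility along one orbit of generalised BIREFLECTIONS.** Let `S ⊆ End_K(V)`, `M ≤ V`, and
`γ_j ∈ S` a family of generalised bireflections: `γ_j x - x ∈ ⟨p_j, q_j⟩` on `M` with `p_j, q_j`
eigenvectors for distinct eigenvalues `a_j ≠ b_j`. Assume: (span) the roots `p_j, q_j` span `M`; (orbit)
every root lies in the `K`-span of the `S`-orbit of every other root; (mirrors) no non-zero vector of `M`
is fixed by all the `γ_j`. Then every `S`-stable `U ≤ M` is `⊥` or `M` — the rank-two form of the
irreducibility argument of Voisin II Thm. 3.27, as needed when the local monodromies are bireflections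
(eigenvalues `i, -i`) rather than reflections. [cite: VoisinHodgeII2003, §3.2.3 Thm. 3.27 (proof)]
[cite: Deligne1980, §4.4] [cite: CarlsonToledo1999, §7] -/
theorem eq_bot_or_eq_of_stable_of_bireflections (S : Set (Module.End K V)) (M : Submodule K V)
    {J : Type*} {γ : J → Module.End K V} (hγS : ∀ j, γ j ∈ S) {p q : J → V} {a b : J → K}
    (hp : ∀ j, γ j (p j) = a j • p j)
    (hq : ∀ j, γ j (q j) = b j • q j) (hab : ∀ j, a j ≠ b j)
    (hrange : ∀ j, ∀ x ∈ M, γ j x - x ∈ Submodule.span K {p j, q j})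
    (hmir : ∀ x ∈ M, (∀ j, γ j x = x) → x = 0)
    (horbit : ∀ r ∈ Set.range p ∪ Set.range q, ∀ s ∈ Set.range p ∪ Set.range q,
      s ∈ Submodule.span K ((fun g : Module.End K V => g r) '' S))
    (hspan : M ≤ Submodule.span K (Set.range p ∪ Set.range q)) {U : Submodule K V} (hUM : U ≤ M)
    (hU : ∀ g ∈ S, ∀ x ∈ U, g x ∈ U) : U = ⊥ ∨ U = M := by
  classical
  rcases eq_or_ne U ⊥ with hU0 | hU0
  · exact Or.inl hU0
  right
  obtain ⟨x, hxU, hx0⟩ := (Submodule.ne_bot_iff U).1 hU0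
  have hj : ∃ j, γ j x ≠ x := by
    by_contra h
    push Not at h
    exact hx0 (hmir x (hUM hxU) h)
  obtain ⟨j, hjx⟩ := hj
  -- a root of `γ_j` is captured
  have hroot : ∃ r ∈ Set.range p ∪ Set.range q, r ∈ U := by
    rcases mem_or_mem_or_forall_eq_of_sub_mem_span_pair (hrange j) (hp j) (hq j) (hab j) hUM
        (hU _ (hγS j)) with h | h | h
    · exact ⟨p j, Or.inl ⟨j, rfl⟩, h⟩
    · exact ⟨q j, Or.inr ⟨j, rfl⟩, h⟩
    · exact absurd (h x hxU) hjx
  obtain ⟨r, hrR, hrU⟩ := hroot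
  -- hence every root lies in `U`, and `U = M`
  have hall : ∀ s ∈ Set.range p ∪ Set.range q, s ∈ U := fun s hs ↦ by
    refine (Submodule.span_le.2 ?_) (horbit r hrR s hs)
    rintro _ ⟨g, hg, rfl⟩
    exact hU g hg _ hrU
  exact le_antisymm hUM (hspan.trans (Submodule.span_le.2 hall))

/-- **The same, in the mirror currency of stub S5.** Bireflections `γ_j ∈ S` given by: eigenvectors
`p_j, q_j ∈ M` with eigenvalues `a_j ≠ b_j`, both `≠ 1`; mirror functionals `φ_j, ψ_j` with non-zero Gram
determinant on `(p_j, q_j)` and the clause «`γ_j` fixes `M ∩ ker φ_j ∩ ker ψ_j`»; the functionals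
SEPARATE `M` (`⋂_j (ker φ_j ∩ ker ψ_j) ∩ M = 0` — for `φ_j = Q(·, B ℓp_j)`, `ψ_j = Q(·, B ℓm_j)` this is
the non-degeneracy of the pairing plus the spanning of the dual roots); the roots form one `S`-orbit up
to `K`-span and span `M`. Then every `S`-stable `U ≤ M` is `⊥` or `M`.
[cite: VoisinHodgeII2003, §3.2.3 Thm. 3.27 (proof)] [cite: Deligne1980, §4.4] -/
theorem eq_bot_or_eq_of_stable_of_bireflections_of_mirrors (S : Set (Module.End K V))
    (M : Submodule K V) {J : Type*} {γ : J → Module.End K V} (hγS : ∀ j, γ j ∈ S) {p q : J → V}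
    (hpM : ∀ j, p j ∈ M) (hqM : ∀ j, q j ∈ M) {a b : J → K} (hp : ∀ j, γ j (p j) = a j • p j)
    (hq : ∀ j, γ j (q j) = b j • q j) (hab : ∀ j, a j ≠ b j) (ha : ∀ j, a j ≠ 1) (hb : ∀ j, b j ≠ 1)
    (φ ψ : J → V →ₗ[K] K) (hD : ∀ j, φ j (p j) * ψ j (q j) - φ j (q j) * ψ j (p j) ≠ 0)
    (hfix : ∀ j, ∀ x ∈ M, φ j x = 0 → ψ j x = 0 → γ j x = x)
    (hsep : ∀ x ∈ M, (∀ j, φ j x = 0 ∧ ψ j x = 0) → x = 0)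
    (horbit : ∀ r ∈ Set.range p ∪ Set.range q, ∀ s ∈ Set.range p ∪ Set.range q,
      s ∈ Submodule.span K ((fun g : Module.End K V => g r) '' S))
    (hspan : M ≤ Submodule.span K (Set.range p ∪ Set.range q)) {U : Submodule K V} (hUM : U ≤ M)
    (hU : ∀ g ∈ S, ∀ x ∈ U, g x ∈ U) : U = ⊥ ∨ U = M :=
  eq_bot_or_eq_of_stable_of_bireflections S M hγS hp hq hab
    (fun j ↦ sub_mem_span_pair_of_forall_eq (hpM j) (hqM j) (hp j) (hq j) (φ j) (ψ j) (hD j) (hfix j))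
    (fun x hxM hx ↦ hsep x hxM fun j ↦
      apply_eq_zero_of_forall_eq (hpM j) (hqM j) (hp j) (hq j) (ha j) (hb j) (φ j) (ψ j) (hD j)
        (hfix j) hxM (hx j))
    horbit hspan hUM hU

end Orbit

end Literature.LinearAlgebra
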